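import Summits.KontsevichZagierPeriods.KontsevichZagierPeriods.Theses.BoundaryLevel

/-!
# `CubicSkinScissors` (crux stmt-KontsevichZagierPeriods-11388) — birth skeleton (`Lines/birth.lean`, BC3)

Route `KontsevichZagierPeriods/BoundaryLevel`, crux `CubicSkinScissors` (rank 3): two volume
representations `r r' : KZ.IntegralRep 3` (integrand `1`, bounded `ℚ`-semialgebraic domains) whose
frontiers lie on smooth affine cubic surfaces `{F = 0}`, `{F' = 0}` with real-algebraic
coefficients and WEIERSTRASS cubic part `y²z − (4x³ − q₂xz² − q₃z³)`, `q₂³ ≠ 27q₃²` (smooth cubic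
curve `E`, `E'` at infinity, `X̄` transverse to `H∞`), and with the same volume, are KZ-equivalent:
`[r] − [r'] ∈ KZ.relations`.

## The cut (two registered stubs, one proved composition)

The crux's own mechanism (route docstring) has two stages — "divergence (one Newton–Leibniz per
cylindrical cell, primitive a coordinate) to 2-dim representations carried by the skin, then Stokes
across `ℚ`-semialgebraic 3-chains of `X°(ℂ) ⊂ ℝ⁶` realising the Huber–Wüstholz certificate" — and
the skeleton is cut exactly there:

* `stub_divergenceToFrontier` — DIVERGENCE INSIDE THE CALCULUS (size M–L, provable now from
  cylindrical decomposition): a bounded integrand-`1` representation `[R, 1]` in `ℝ³` is congruent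
  modulo `KZ.relations` to a signed sum `Σ εᵢ·[τᵢ, bᵢ]` of 2-dimensional representations whose
  graph points `(v₀, v₁, bᵢ v)` lie in `frontier R` (the `bᵢ` are the section functions bounding
  the maximal vertical runs of `R` over the cells `τᵢ` of an adapted CAD; rule (1a) splits `R`,
  null pieces are relations, rule (3) with primitive `t` integrates each closed run to
  `[τ, b − a]`, rule (1b) splits it as `[τ, b] − [τ, a]`). No cubic, no transcendence: pure
  semialgebraic geometry of the calculus; it is the "divergence theorem as a chain of moves".
* `stub_skinStokes` — CONJECTURE 1 ON THE CUBIC-SKIN SECTOR OF 2-DIMENSIONAL REPRESENTATIONS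
  (size XL, the heart of the crux): two finite signed families of bounded 2-dimensional
  representations carried by the skins (`F (v₀, v₁, b v) = 0` on the domain), over two cubics of
  the stated shape, with the same signed total value, are congruent modulo `KZ.relations`. By
  `CubicSkinVolumes`-type bookkeeping these values are `2πi ×` incomplete periods of the 1-motives
  of `(X°, skin curves)`; Huber–Wüstholz (HuberWustholz2022 Thm 13.3, cited, never imported) turns
  "equal value" into a certificate (isogeny / torsion of boundary points / exact forms), and the
  stub is the claim that every certificate is a chain of rules (1)–(3) through semialgebraic
  3-chains of `X°(ℂ) ⊂ ℝ⁶`.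

`CubicSkinScissors_of : CubicSkinScissors` is the composition, proved here with no `sorry` outside
the two `stub_*`: divergence on both solids; `frontier R ⊆ {F = 0}` makes the pieces skin-carried;
the pieces are bounded because they lie in the closure of the bounded domain; the signed values
agree by SOUNDNESS of the calculus (`KZ.relations_le_ker_eval_holds`, proved in the tree) and
`r.value = r'.value`; `stub_skinStokes` gives the middle congruence; reassemble
`[r] − [r'] = ([r] − Σ) + (Σ − Σ') − ([r'] − Σ')`.

Neither stub is the crux or the summit: `stub_divergenceToFrontier` concludes no equivalence of
solids at all (it is a normal-form lemma about one representation), and `stub_skinStokes` speaks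
only of 2-dimensional representations (`KZ.IntegralRep 2`) carried by cubic skins — the crux's
3-dimensional solids enter it only through the divergence stub (BC3 probes
`stub → CubicSkinScissors`, `stub → KontsevichZagierPeriods` by `first | exact? | simpa | aesop`
fail, see the birth note). Disproof used: none on file for this crux (no `Disproof.lean`,
`ledger crux ls` empty at registration).

References: M. Kontsevich, D. Zagier, *Periods* (2001), §1.2 (rules (1)–(3), Conjecture 1);
A. Huber, G. Wüstholz, *Transcendence and linear relations of 1-periods* (2022), Thm. 13.3;
J. Bochnak, M. Coste, M.-F. Roy, *Real Algebraic Geometry* (1998), §2.3, §5 (cylindrical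
decomposition, semialgebraic section functions); J. Cresson, J. Viu-Sos, *On the equality of
periods of Kontsevich–Zagier* (2022), §3 (Stokes moves on semialgebraic chains).
-/

noncomputable section

open Set MeasureTheory MvPolynomial
open Literature.NumberTheory.Transcendental
open Summit.KontsevichZagierPeriods.KontsevichZagierPeriods.Theses.BoundaryLevel

set_option linter.dupNamespace false

namespace Summit.KontsevichZagierPeriods.KontsevichZagierPeriods.Cruxes.CubicSkinScissors.Birth

/-! ### Registered stubs -/

/-- **Stub** `stub_divergenceToFrontier` (the divergence theorem as a chain of moves; size M–L).
For an integral representation `r` in `ℝ³` with integrand `1` on its bounded (`ℚ`-semialgebraic)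
domain `R`, there are finitely many 2-dimensional representations `sᵢ = [τᵢ, bᵢ]` and signs
`εᵢ ∈ ℤ` such that every graph point `(v₀, v₁, bᵢ v)`, `v ∈ τᵢ`, lies in `frontier R`, and
`[r] − Σ εᵢ·[sᵢ] ∈ KZ.relations`. Chain: a cylindrical algebraic decomposition of `ℝ³` adapted to
`R` (last coordinate `t`); over each open cell `τ ⊆ ℝ²` the set `R ∩ (τ × ℝ)` is a finite union of
maximal vertical runs `{a(v) ◁ t ◁ b(v)}` bounded by consecutive `ℚ`-semialgebraic section
functions (finite since `R` is bounded), whose end points `(v, a v)`, `(v, b v)` are frontier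
points of `R` (points just outside the run are not in `R`, points just inside are); rule (1a)
splits `[r]` along the cells and runs (lower-dimensional pieces are null, hence relations), the
closed run differs from the run by null sections, rule (3) with the primitive `F (v, t) = t`
gives `[run, 1] − [τ, b − a] ∈ relations`, and rule (1b) gives `[τ, b − a] ≡ [τ, b] − [τ, a]`.
[cite: KontsevichZagier2001, §1.2 rules (1), (3)] [cite: BochnakCosteRoy1998, §2.3, §5] -/
theorem stub_divergenceToFrontier (r : KZ.IntegralRep 3)
    (h1 : ∀ x ∈ r.domain, r.integrand x = 1) (hb : Bornology.IsBounded r.domain) :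
    ∃ (k : ℕ) (ε : Fin k → ℤ) (s : Fin k → KZ.IntegralRep 2),
      (∀ i, ∀ v ∈ (s i).domain,
        (![v 0, v 1, (s i).integrand v] : Fin 3 → ℝ) ∈ frontier r.domain) ∧
      KZ.of r - ∑ i, ε i • KZ.of (s i) ∈ KZ.relations := by
  sorry

/-- **Stub** `stub_skinStokes` (Conjecture 1 on the cubic-skin sector of 2-dimensional
representations; size XL — the heart of the crux). Let `F, F' ∈ (ℚ̄ ∩ ℝ)[x, y, z]` have degree
`≤ 3`, Weierstrass cubic parts `y²z − (4x³ − q₂xz² − q₃z³)`, `y²z − (4x³ − q₂'xz² − q₃'z³)` with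
`q₂³ ≠ 27q₃²`, `q₂'³ ≠ 27q₃'²` (smooth cubic curves `E, E'` at infinity), and smooth complex affine
zero loci. Let `(εᵢ, sᵢ)_{i<k}`, `(ε'ⱼ, s'ⱼ)_{j<k'}` be finite signed families of 2-dimensional
integral representations CARRIED BY THE SKINS — `F (v₀, v₁, sᵢ.integrand v) = 0` for
`v ∈ sᵢ.domain`, likewise for `F'` — with bounded graphs. If the signed values agree,
`Σ εᵢ·value(sᵢ) = Σ ε'ⱼ·value(s'ⱼ)`, then `Σ εᵢ·[sᵢ] − Σ ε'ⱼ·[s'ⱼ] ∈ KZ.relations`.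
Mechanism: the values are `2πi ×` incomplete periods of the 1-motives attached to
`H₂(X°, skin curves)`, `X° = X̄ ∖ E` (weights `2, 3` only, `CubicSkinVolumes` bookkeeping);
by Huber–Wüstholz every `ℚ̄`-linear relation among such periods is generated by bilinearity,
functoriality (isogenies `E ∼ E'`, torsion of the boundary points) and exact forms, i.e. comes
with a geometric certificate; the claim is that each certificate is a finite chain of rules
(1)–(3): Stokes across `ℚ`-semialgebraic 3-chains of `X°(ℂ) ⊂ ℝ⁶` realising the homology between
the skin 2-chains, tubes over 1-cycles of `E` and the classes of the 27 lines, cut into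
Newton–Leibniz moves by cylindrical decomposition. A single underivable Huber–Wüstholz identity
here refutes `VolumeForm` and the summit.
[cite: KontsevichZagier2001, §1.2 Conjecture 1] [cite: HuberWustholz2022, Thm. 13.3]
[cite: CressonViusos2022, §3] -/
theorem stub_skinStokes (F F' : MvPolynomial (Fin 3) ℝ) (q₂ q₃ q₂' q₃' : ℝ)
    (hF : ∀ d, IsAlgebraic ℚ (F.coeff d)) (hq₂ : IsAlgebraic ℚ q₂) (hq₃ : IsAlgebraic ℚ q₃)
    (hΔ : q₂ ^ 3 - 27 * q₃ ^ 2 ≠ 0) (hdeg : F.totalDegree ≤ 3)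
    (hhom : MvPolynomial.homogeneousComponent 3 F =
      MvPolynomial.X 1 ^ 2 * MvPolynomial.X 2 - (4 * MvPolynomial.X 0 ^ 3 -
        MvPolynomial.C q₂ * MvPolynomial.X 0 * MvPolynomial.X 2 ^ 2 -
        MvPolynomial.C q₃ * MvPolynomial.X 2 ^ 3))
    (hsm : ∀ z : Fin 3 → ℂ, MvPolynomial.aeval z F = 0 →
      ∃ i, MvPolynomial.aeval z (MvPolynomial.pderiv i F) ≠ 0)
    (hF' : ∀ d, IsAlgebraic ℚ (F'.coeff d)) (hq₂' : IsAlgebraic ℚ q₂') (hq₃' : IsAlgebraic ℚ q₃')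
    (hΔ' : q₂' ^ 3 - 27 * q₃' ^ 2 ≠ 0) (hdeg' : F'.totalDegree ≤ 3)
    (hhom' : MvPolynomial.homogeneousComponent 3 F' =
      MvPolynomial.X 1 ^ 2 * MvPolynomial.X 2 - (4 * MvPolynomial.X 0 ^ 3 -
        MvPolynomial.C q₂' * MvPolynomial.X 0 * MvPolynomial.X 2 ^ 2 -
        MvPolynomial.C q₃' * MvPolynomial.X 2 ^ 3))
    (hsm' : ∀ z : Fin 3 → ℂ, MvPolynomial.aeval z F' = 0 →
      ∃ i, MvPolynomial.aeval z (MvPolynomial.pderiv i F') ≠ 0)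
    (k k' : ℕ) (ε : Fin k → ℤ) (ε' : Fin k' → ℤ)
    (s : Fin k → KZ.IntegralRep 2) (s' : Fin k' → KZ.IntegralRep 2)
    (hs : ∀ i, ∀ v ∈ (s i).domain,
      MvPolynomial.eval (![v 0, v 1, (s i).integrand v] : Fin 3 → ℝ) F = 0)
    (hs' : ∀ j, ∀ v ∈ (s' j).domain,
      MvPolynomial.eval (![v 0, v 1, (s' j).integrand v] : Fin 3 → ℝ) F' = 0)
    (hM : ∃ M : ℝ, ∀ i, ∀ v ∈ (s i).domain,
      ‖(![v 0, v 1, (s i).integrand v] : Fin 3 → ℝ)‖ ≤ M)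
    (hM' : ∃ M' : ℝ, ∀ j, ∀ v ∈ (s' j).domain,
      ‖(![v 0, v 1, (s' j).integrand v] : Fin 3 → ℝ)‖ ≤ M')
    (hval : ∑ i, (ε i : ℝ) * (s i).value = ∑ j, (ε' j : ℝ) * (s' j).value) :
    (∑ i, ε i • KZ.of (s i)) - ∑ j, ε' j • KZ.of (s' j) ∈ KZ.relations := by
  sorry

/-! ### Proved glue -/

/-- Value bookkeeping through SOUNDNESS of the calculus: if `[r] − Σ εᵢ·[sᵢ] ∈ relations` then
`value r = Σ εᵢ · value sᵢ` (`KZ.relations_le_ker_eval_holds`).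
[cite: KontsevichZagier2001, §1.2] -/
theorem value_eq_sum_of_sub_sum_mem_relations {d e k : ℕ} (r : KZ.IntegralRep d) (ε : Fin k → ℤ)
    (s : Fin k → KZ.IntegralRep e) (h : KZ.of r - ∑ i, ε i • KZ.of (s i) ∈ KZ.relations) :
    r.value = ∑ i, (ε i : ℝ) * (s i).value := by
  have h' := KZ.relations_le_ker_eval_holds h
  rw [AddMonoidHom.mem_ker, map_sub, map_sum, KZ.eval_of, sub_eq_zero] at h'
  rw [h']
  refine Finset.sum_congr rfl fun i _ => ?_
  rw [map_zsmul, KZ.eval_of, zsmul_eq_mul]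

/-! ### The composition -/

/-- **Composition.** `CubicSkinScissors` from the two registered stubs: divergence turns both
solids into signed families of 2-dimensional representations on their frontiers
(`stub_divergenceToFrontier`), hence carried by the skins (`frontier R ⊆ {F = 0}`) and bounded
(they lie in the closure of the bounded domain); soundness of the calculus transports
`value r = value r'` to the equality of the signed values; Conjecture 1 on the skin sector
(`stub_skinStokes`) makes the two families congruent; and
`[r] − [r'] = ([r] − Σ) + (Σ − Σ') − ([r'] − Σ')`.
[cite: KontsevichZagier2001, §1.2 Conjecture 1] [cite: HuberWustholz2022, Thm. 13.3] -/
theorem CubicSkinScissors_of : CubicSkinScissors := by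
  intro F F' q₂ q₃ q₂' q₃' r r' hF hq₂ hq₃ hΔ hdeg hhom hsm h1 hb hfr hF' hq₂' hq₃' hΔ' hdeg' hhom'
    hsm' h1' hb' hfr' hval
  -- (1) divergence: both solids become signed families of 2-dimensional representations
  obtain ⟨k, ε, s, hs, hrel⟩ := stub_divergenceToFrontier r h1 hb
  obtain ⟨k', ε', s', hs', hrel'⟩ := stub_divergenceToFrontier r' h1' hb'
  -- (2) the pieces are carried by the skins
  have hskin : ∀ i, ∀ v ∈ (s i).domain,
      MvPolynomial.eval (![v 0, v 1, (s i).integrand v] : Fin 3 → ℝ) F = 0 :=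
    fun i v hv => hfr (hs i v hv)
  have hskin' : ∀ j, ∀ v ∈ (s' j).domain,
      MvPolynomial.eval (![v 0, v 1, (s' j).integrand v] : Fin 3 → ℝ) F' = 0 :=
    fun j v hv => hfr' (hs' j v hv)
  -- (3) the pieces are bounded: they lie in the closure of the bounded domains
  obtain ⟨M, hM⟩ := isBounded_iff_forall_norm_le.1 hb.closure
  obtain ⟨M', hM'⟩ := isBounded_iff_forall_norm_le.1 hb'.closure
  have hbd : ∃ M : ℝ, ∀ i, ∀ v ∈ (s i).domain,
      ‖(![v 0, v 1, (s i).integrand v] : Fin 3 → ℝ)‖ ≤ M :=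
    ⟨M, fun i v hv => hM _ (frontier_subset_closure (hs i v hv))⟩
  have hbd' : ∃ M' : ℝ, ∀ j, ∀ v ∈ (s' j).domain,
      ‖(![v 0, v 1, (s' j).integrand v] : Fin 3 → ℝ)‖ ≤ M' :=
    ⟨M', fun j v hv => hM' _ (frontier_subset_closure (hs' j v hv))⟩
  -- (4) values, through soundness of the calculus
  have hv : r.value = ∑ i, (ε i : ℝ) * (s i).value :=
    value_eq_sum_of_sub_sum_mem_relations r ε s hrel
  have hv' : r'.value = ∑ j, (ε' j : ℝ) * (s' j).value :=
    value_eq_sum_of_sub_sum_mem_relations r' ε' s' hrel'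
  have hvals : ∑ i, (ε i : ℝ) * (s i).value = ∑ j, (ε' j : ℝ) * (s' j).value := by
    rw [← hv, ← hv']
    exact hval
  -- (5) Conjecture 1 on the cubic-skin sector of 2-dimensional representations
  have key : (∑ i, ε i • KZ.of (s i)) - ∑ j, ε' j • KZ.of (s' j) ∈ KZ.relations :=
    stub_skinStokes F F' q₂ q₃ q₂' q₃' hF hq₂ hq₃ hΔ hdeg hhom hsm hF' hq₂' hq₃' hΔ' hdeg' hhom'
      hsm' k k' ε ε' s s' hskin hskin' hbd hbd' hvals
  -- (6) reassemble
  have hsplit : KZ.of r - KZ.of r' =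
      (KZ.of r - ∑ i, ε i • KZ.of (s i)) + ((∑ i, ε i • KZ.of (s i)) - ∑ j, ε' j • KZ.of (s' j)) -
        (KZ.of r' - ∑ j, ε' j • KZ.of (s' j)) := by
    abel
  show KZ.of r - KZ.of r' ∈ KZ.relations
  rw [hsplit]
  exact KZ.relations.sub_mem (KZ.relations.add_mem hrel key) hrel'

end Summit.KontsevichZagierPeriods.KontsevichZagierPeriods.Cruxes.CubicSkinScissors.Birth

end
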